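import Mathlib
import Literature.MathematicalPhysics.QuantumFieldTheory.Balaban1983to89.Beta.DecimatedMomentSummable
import Literature.MathematicalPhysics.QuantumFieldTheory.Balaban1983to89.Beta.DressedMomentNormalisation

/-!
# Road «FP» (binder row D1), REP∞ — ALG-2, the PERIODIC transport identity (algebraic core)

`HOME/b2b-balaban-beta-d1-p3/REP-DESIGN.md` v1.1: for a transport column `h : ℤ^d → ℝ` reproducing constants and linear data through
the window `N•ℤ^d` ((L0) `ConstReproSum N h σ`, (L1) `LinReproSum N h C`) and a fine kernel `B : ℤ^d → ℤ^d → ℝ` that is only JOINTLY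
`N`-periodic with (T0) at both vertices, the `N•ℤ^d`-decimated second moment of the dressed kernel `y ↦ Σ'_{u,x} h(u)·B(u, x+y)·h(x)` is
`σ² · Σ_{a ∈ R} Σ'_v (v − a)_κ (v − a)_λ · B(a, v)` — the base-point SUM of the fine second moments about the base point (with the bond
normalisation `σ = N^{−(d+1)}` and the `N^{2d}` of `coarseTensor`: the base-point AVERAGE).  It generalises an4's convolution-kernel
`DressedMomentNormalisation.bondSecondMoment_hasSum` (`B(u,x) = T(u − x)`); only (T0) is used (the first-moment cross terms cancel), the
second coset moments `Q` of `h` may depend on the coset and drop out.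

THIS FILE, v1 — the two ALGEBRAIC COLLAPSES of the derivation (no Fubini yet):
* §1 `cosetSecond` — the coset second moments `Q a κ l := Σ'_x cosetInd N (a − x)·x_κ x_λ · h x` (exist under `AbsMoment₂ h`;
  `N`-periodic in `a`); **`hasSum_right_collapse`** (E1): `Σ'_x cosetInd N (b − x)·(b − x)_κ(b − x)_λ·h x = σ b_κ b_λ − b_κ C_λ − C_κ b_λ + Q b κ l`.
* §2 **`hasSum_left_collapse`** (E2): for the coset of `a`, `Σ'_u cosetInd N (a − u)·h u·P(v − a + u)` with
  `P y := σ y_κ y_λ − y_κ C_λ − C_κ y_λ + q` equals `σ²(v − a)_κ(v − a)_λ + σ·Q a κ l + σ q − 2 C_κ C_λ + [(v−a)-linear terms that CANCEL]`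
  — precisely: `σ(σ Δ_κΔ_λ + Δ_κ C_λ + C_κ Δ_λ + Q a κ l) − (σΔ_κ + C_κ) C_λ − C_κ (σΔ_λ + C_λ) + σ q`, `Δ := v − a`.
The assembly (decimation reindexing, the two Fubini interchanges, the residue decomposition of the first vertex, and the two uses
of (T0)) follows in v2 (`periodicTransport_hasSum`).  [folklore] throughout; `d` arbitrary; nothing about Bałaban's objects is asserted.
HONEST FRAMING: bookkeeping toward `hident` (GAPS O-asym1-7); discharges nothing of `BetaPertH`; NOT the continuum limit, NOT Clay.
-/

noncomputable section

open Filter Topology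
open scoped BigOperators

namespace Summit.QuantumFields.BalabanUV.Beta.FP.PeriodicTransport

open Literature.MathematicalPhysics.QuantumFieldTheory.Balaban1983to89
open Literature.MathematicalPhysics.QuantumFieldTheory.Balaban1983to89.Beta
open Literature.MathematicalPhysics.QuantumFieldTheory.Balaban1983to89.Beta.DecimatedMoment (cosetInd)
open Literature.MathematicalPhysics.QuantumFieldTheory.Balaban1983to89.Beta.DecimatedMomentLimit (abs_cosetInd_le_one)
open Literature.MathematicalPhysics.QuantumFieldTheory.Balaban1983to89.Beta.DecimatedMomentSummable
  (ConstReproSum LinReproSum AbsMoment₂ summable_smul_of_absMoment₂ IsMoment₂)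

variable {d : ℕ}

/-! ## §1 Coset second moments and the RIGHT collapse (E1) -/

/-- [our object] **Coset second moments** of a pattern `h` through the window `N•ℤ^d`: `Q a κ l := Σ'_x cosetInd N (a − x)·(x_κ x_λ)·h x`. -/
def cosetSecond (N : ℕ) (h : (Fin d → ℤ) → ℝ) (a : Fin d → ℤ) (κ l : Fin d) : ℝ :=
  ∑' x : Fin d → ℤ, (cosetInd N (a - x) * (x κ * x l)) • h x

/-- [folklore] Under `AbsMoment₂ h` every windowed family with a weight of the alphabet `IsMoment₂` is summable. -/
theorem summable_coset_smul {N : ℕ} {h : (Fin d → ℤ) → ℝ} (hh : AbsMoment₂ h) (a : Fin d → ℤ) {p : (Fin d → ℤ) → ℤ}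
    (hp : IsMoment₂ p) : Summable fun x : Fin d → ℤ => (cosetInd N (a - x) * p x) • h x :=
  DecimatedMomentSummable.summable_window_smul_of_absMoment₂ hh (χ := fun x => cosetInd N (a - x))
    (fun x => abs_cosetInd_le_one N (a - x)) hp

/-- [folklore] The coset second-moment family HAS the sum `cosetSecond N h a κ l`. -/
theorem hasSum_cosetSecond {N : ℕ} {h : (Fin d → ℤ) → ℝ} (hh : AbsMoment₂ h) (a : Fin d → ℤ) (κ l : Fin d) :
    HasSum (fun x : Fin d → ℤ => (cosetInd N (a - x) * (x κ * x l)) • h x) (cosetSecond N h a κ l) :=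
  (summable_coset_smul hh a (IsMoment₂.coord2 κ l)).hasSum

/-- [folklore] The window is `N`-periodic in the base point: `cosetInd N (a + N•t − x) = cosetInd N (a − x)`. -/
theorem cosetInd_add_zsmul_sub (N : ℕ) (a t x : Fin d → ℤ) :
    cosetInd N (a + (N : ℤ) • t - x) = cosetInd N (a - x) := by
  unfold cosetInd
  have key : (∀ i, (N : ℤ) ∣ (a + (N : ℤ) • t - x) i) ↔ ∀ i, (N : ℤ) ∣ (a - x) i := by
    refine forall_congr' fun i => ?_
    simp only [Pi.sub_apply, Pi.add_apply, Pi.smul_apply, smul_eq_mul]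
    constructor
    · intro hdiv
      have : (a i + (N : ℤ) * t i - x i) - (N : ℤ) * t i = a i - x i := by ring
      rw [← this]; exact dvd_sub hdiv (dvd_mul_right _ _)
    · intro hdiv
      have : a i + (N : ℤ) * t i - x i = (a i - x i) + (N : ℤ) * t i := by ring
      rw [this]; exact dvd_add hdiv (dvd_mul_right _ _)
  simp only [key]

/-- [folklore] The coset second moments are `N`-periodic in the base point. -/
theorem cosetSecond_add_zsmul (N : ℕ) (h : (Fin d → ℤ) → ℝ) (a t : Fin d → ℤ) (κ l : Fin d) :
    cosetSecond N h (a + (N : ℤ) • t) κ l = cosetSecond N h a κ l := by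
  unfold cosetSecond
  exact tsum_congr fun x => by rw [cosetInd_add_zsmul_sub]

/-- [folklore] **(E1) THE RIGHT COLLAPSE.**  Under (L0) `ConstReproSum N h σ`, (L1) `LinReproSum N h C` and `AbsMoment₂ h`:
`Σ'_x cosetInd N (b − x)·(b − x)_κ (b − x)_λ·h x = σ·b_κ b_λ − b_κ·C_λ − C_κ·b_λ + Q b κ l`. -/
theorem hasSum_right_collapse {N : ℕ} {h : (Fin d → ℤ) → ℝ} {σ : ℝ} {C : Fin d → ℝ} (h0 : ConstReproSum N h σ)
    (h1 : LinReproSum N h C) (hh : AbsMoment₂ h) (b : Fin d → ℤ) (κ l : Fin d) :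
    HasSum (fun x : Fin d → ℤ => (cosetInd N (b - x) * ((b - x) κ * (b - x) l)) • h x)
      (σ * ((b κ : ℝ) * (b l : ℝ)) - (b κ : ℝ) * C l - C κ * (b l : ℝ) + cosetSecond N h b κ l) := by
  have e0 := h0 b
  have e1κ := h1 b κ
  have e1l := h1 b l
  have e2 := hasSum_cosetSecond (N := N) hh b κ l
  -- `(b−x)_κ(b−x)_λ = b_κb_λ − b_κ x_λ − x_κ b_λ + x_κ x_λ`, termwise in `ℝ`
  have hsum := (((e0.mul_left ((b κ : ℝ) * (b l : ℝ))).sub (e1l.mul_left (b κ : ℝ))).sub (e1κ.mul_left (b l : ℝ))).add e2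
  have ef : (fun x : Fin d → ℤ => (cosetInd N (b - x) * ((b - x) κ * (b - x) l)) • h x)
      = fun x => (b κ : ℝ) * (b l : ℝ) * (cosetInd N (b - x) • h x) - (b κ : ℝ) * ((cosetInd N (b - x) * x l) • h x)
          - (b l : ℝ) * ((cosetInd N (b - x) * x κ) • h x) + (cosetInd N (b - x) * (x κ * x l)) • h x := by
    funext x
    simp only [zsmul_eq_mul, Int.cast_mul, Pi.sub_apply, Int.cast_sub]
    ring
  have ev : σ * ((b κ : ℝ) * (b l : ℝ)) - (b κ : ℝ) * C l - C κ * (b l : ℝ) + cosetSecond N h b κ l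
      = (b κ : ℝ) * (b l : ℝ) * σ - (b κ : ℝ) * C l - (b l : ℝ) * C κ + cosetSecond N h b κ l := by ring
  rw [ef, ev]
  exact hsum

/-! ## §2 The LEFT collapse (E2) over the coset of the base point -/

/-- [folklore] **(E2) THE LEFT COLLAPSE.**  Fix a base point `a`, a fine point `v`, put `Δ := v − a`, and let `P` be the right-collapsed
weight `P y := σ·y_κ y_λ − y_κ·C_λ − C_κ·y_λ + q` with a CONSTANT `q` (in the application: `q = Q v κ l`, constant along the coset sum
over `u`).  Then the coset sum `Σ'_u cosetInd N (a − u)·h u·P(Δ + u)` equals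
`σ(σΔ_κΔ_λ + Δ_κC_λ + C_κΔ_λ + Q a κ l) − (σΔ_κ + C_κ)·C_λ − C_κ·(σΔ_λ + C_λ) + σ·q` — whose `Δ`-LINEAR TERMS CANCEL:
`= σ²Δ_κΔ_λ + σ·Q a κ l + σ·q − 2·C_κC_λ` (`left_collapse_value`). -/
theorem hasSum_left_collapse {N : ℕ} {h : (Fin d → ℤ) → ℝ} {σ : ℝ} {C : Fin d → ℝ} (h0 : ConstReproSum N h σ)
    (h1 : LinReproSum N h C) (hh : AbsMoment₂ h) (a v : Fin d → ℤ) (κ l : Fin d) (q : ℝ) :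
    HasSum (fun u : Fin d → ℤ => (cosetInd N (a - u) : ℝ) * h u *
        (σ * (((v - a + u) κ : ℤ) : ℝ) * (((v - a + u) l : ℤ) : ℝ) - (((v - a + u) κ : ℤ) : ℝ) * C l
          - C κ * (((v - a + u) l : ℤ) : ℝ) + q))
      (σ * (σ * ((((v - a) κ : ℤ) : ℝ) * (((v - a) l : ℤ) : ℝ)) + (((v - a) κ : ℤ) : ℝ) * C l + C κ * (((v - a) l : ℤ) : ℝ)
          + cosetSecond N h a κ l)
        - (σ * (((v - a) κ : ℤ) : ℝ) + C κ) * C l - C κ * (σ * (((v - a) l : ℤ) : ℝ) + C l) + σ * q) := by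
  have e0 := h0 a
  have e1κ := h1 a κ
  have e1l := h1 a l
  have e2 := hasSum_cosetSecond (N := N) hh a κ l
  set Dκ : ℝ := (((v - a) κ : ℤ) : ℝ) with hDκ
  set Dl : ℝ := (((v - a) l : ℤ) : ℝ) with hDl
  -- the target as a linear combination of the four coset families (masses σ, C κ, C l, Q)
  have hsum := (((e0.mul_left (σ * (Dκ * Dl) - Dκ * C l - C κ * Dl + q)).add
    (e1κ.mul_left (σ * Dl - C l))).add (e1l.mul_left (σ * Dκ - C κ))).add (e2.mul_left σ)
  have ef : (fun u : Fin d → ℤ => (cosetInd N (a - u) : ℝ) * h u *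
        (σ * (((v - a + u) κ : ℤ) : ℝ) * (((v - a + u) l : ℤ) : ℝ) - (((v - a + u) κ : ℤ) : ℝ) * C l
          - C κ * (((v - a + u) l : ℤ) : ℝ) + q))
      = fun u => (σ * (Dκ * Dl) - Dκ * C l - C κ * Dl + q) * (cosetInd N (a - u) • h u)
          + (σ * Dl - C l) * ((cosetInd N (a - u) * u κ) • h u)
          + (σ * Dκ - C κ) * ((cosetInd N (a - u) * u l) • h u)
          + σ * ((cosetInd N (a - u) * (u κ * u l)) • h u) := by
    funext u
    simp only [zsmul_eq_mul, Int.cast_mul, Pi.add_apply, Pi.sub_apply, Int.cast_add, Int.cast_sub, hDκ, hDl]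
    ring
  have ev : σ * (σ * (Dκ * Dl) + Dκ * C l + C κ * Dl + cosetSecond N h a κ l)
        - (σ * Dκ + C κ) * C l - C κ * (σ * Dl + C l) + σ * q
      = (σ * (Dκ * Dl) - Dκ * C l - C κ * Dl + q) * σ + (σ * Dl - C l) * C κ + (σ * Dκ - C κ) * C l
          + σ * cosetSecond N h a κ l := by ring
  rw [ef, ev]
  exact hsum

/-- [folklore] **The `Δ`-linear terms cancel**: the value of (E2) is `σ²Δ_κΔ_λ + σ·Q a κ l + σ·q − 2·C_κC_λ`. -/
theorem left_collapse_value (σ q Qa Dκ Dl Cκ Cl : ℝ) :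
    σ * (σ * (Dκ * Dl) + Dκ * Cl + Cκ * Dl + Qa) - (σ * Dκ + Cκ) * Cl - Cκ * (σ * Dl + Cl) + σ * q
      = σ ^ 2 * (Dκ * Dl) + σ * Qa + σ * q - 2 * (Cκ * Cl) := by
  ring

end Summit.QuantumFields.BalabanUV.Beta.FP.PeriodicTransport

end
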